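import Mathlib.NumberTheory.NumberField.CanonicalEmbedding.Basic
import Mathlib.NumberTheory.NumberField.InfinitePlace.Embeddings
import Mathlib.Algebra.Algebra.NonUnitalHom
import Mathlib.Algebra.Lie.OfAssociative
import Literature.NumberTheory.Automorphic.HarishChandraGL
import Literature.NumberTheory.Automorphic.InfinityType
import HarnessLib

-- provenance: harness21/H21/H21/Prelude/AutomorphicL/ArchimedeanGLn.lean @ b69613a (interim HEAD d8f2665); M5 mechanical rewrite
/-!
# Archimedean parameters for `GLₙ` over a number field, place by place

Trunk: AutomorphicL (prelude, item I14 `ArchimedeanGLn`; notions `archimedean_gK_module`,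
`algebraic_infinity_type`; design D3, reviews 4 and 12).

Let `K` be a number field and `K_∞ = K ⊗_ℚ ℝ = ∏_{w real} ℝ × ∏_{w complex} ℂ`, which in Mathlib is
LITERALLY `NumberField.mixedEmbedding.mixedSpace K` (with `K ↪ K_∞` the mixed embedding, whose
`w`-component at a complex place is `w.embedding : K →+* ℂ`). Hence
`𝔤_∞ = 𝔤𝔩ₙ(K_∞) = Matrix (Fin n) (Fin n) (mixedSpace K) = ⨁_{w real} 𝔤𝔩ₙ(ℝ) ⊕ ⨁_{w complex} 𝔤𝔩ₙ(ℂ)`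
as real Lie algebras. This file provides the inclusions of the factors,
`realPlaceLie w : 𝔤𝔩ₙ(ℝ) →ₗ⁅ℝ⁆ 𝔤_∞` and `complexPlaceLie w : 𝔤𝔩ₙ(ℂ) →ₗ⁅ℝ⁆ 𝔤_∞` (entrywise
`Pi.single` into the `w`-factor), and uses them to say that a real Lie algebra representation
`ρ𝔤 : 𝔤_∞ →ₗ⁅ℝ⁆ End_ℂ(V)` has a given *archimedean (Harish-Chandra / Langlands) parameter*, i.e. a
family of multisets of `n` complex numbers indexed by the complex embeddings `σ : K →+* ℂ`
(Clozel 1990, §3.3; Buzzard–Gee 2014, §3.1): at a real place `w` (one embedding `σ_w`) the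
`𝔤𝔩ₙ(ℝ)`-module `ρ𝔤 ∘ realPlaceLie w` has Harish-Chandra parameter `χ σ_w`; at a complex place `w`
(two embeddings `σ_w`, `σ̄_w = τ ∘ σ_w` for `τ ∈ {id, conj} = (ℂ →ₐ[ℝ] ℂ)`) the `𝔤𝔩ₙ(ℂ)`-module
`ρ𝔤 ∘ complexPlaceLie w` has parameter `τ ↦ χ (τ ∘ σ_w)` (file `HarishChandraGL`, whose
parameters for `𝔤𝔩ₙ(𝕜)` are indexed by `𝕜 →ₐ[ℝ] ℂ`).

Following D3 / review 4, algebraicity is expressed with G19's `InfinityType K n`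
(file `Literature.Prelude.AutomorphicAxiomatic.InfinityType`): `HasInfinityTypeLie ρ𝔤 T` says that `T`
is well formed and the multisets of `a`-exponents `{a_i}` of `T σ` are the archimedean parameter.
**Subtlety (recorded, not resolved):** the infinitesimal character of `π_w` determines the multiset
`{a_i}` at `σ` and the multiset `{b_i} = {a_i at σ̄}`, but *not* the pairing `(a_i, b_i)` making up
the individual characters `z ↦ z^{a_i} z̄^{b_i}` of the Langlands parameter; so `T` with
`HasInfinityTypeLie ρ𝔤 T` is not unique. All predicates consumed downstream (`IsRegular`,
`IsLAlgebraic`, `IsCAlgebraic`, `IsRegularAlgebraic`) only read these multisets, hence are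
independent of the choice (Clozel 1990, §3.3–3.5; Buzzard–Gee 2014, §3.1).

## Main definitions

* `Literature.Automorphic.mapMatrixLie f` — the real Lie algebra map `𝔤𝔩_N(A) → 𝔤𝔩_N(B)` induced
  entrywise by a non-unital algebra map `f : A →ₙₐ[R] B` (Mathlib has `AlgHom.toLieHom` and
  `RingHom.mapMatrix`/`LinearMap.mapMatrix`, but no non-unital / matrix Lie version).
* `Literature.Automorphic.realPlaceHom w : ℝ →ₙₐ[ℝ] mixedSpace K`,
  `Literature.Automorphic.complexPlaceHom w : ℂ →ₙₐ[ℝ] mixedSpace K` — inclusion of the `w`-factor.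
* `Literature.Automorphic.realPlaceLie n w`, `Literature.Automorphic.complexPlaceLie n w` — the Lie algebra
  inclusions `𝔤𝔩ₙ(ℝ), 𝔤𝔩ₙ(ℂ) ↪ 𝔤𝔩ₙ(K_∞)`.
* `Literature.Automorphic.HasArchParameter ρ𝔤 χ` — `ρ𝔤` has archimedean parameter
  `χ : (K →+* ℂ) → Multiset ℂ`.
* `Literature.Automorphic.HasInfinityTypeLie ρ𝔤 T` — `ρ𝔤` has (well-formed) infinity type `T`.
* `Literature.Automorphic.weightZeroInfinityType n K` — the infinity type `σ ↦ {(ρ_i, -ρ_i)}_i` of the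
  tempered cohomological representation of weight zero (parameter `z ↦ (z/z̄)^{ρ_i}`).

## Main statements

* `isWellFormed_weightZeroInfinityType`, `isRegularAlgebraic_weightZeroInfinityType` (proved).

## Design notes

* (H1) commutator brackets via `attribute [local instance 100] LieRing.ofAssociativeRing`.
* (H5) `open scoped Classical` (the place subtypes index `Fintype` products in `mixedSpace K`).
* Mathlib anchors used: `NumberField.mixedEmbedding.mixedSpace`, `NumberField.InfinitePlace.IsReal`,
  `IsComplex`, `InfinitePlace.embedding`, `Pi.single`, `Matrix.map`, `NonUnitalAlgHom`. Mathlib has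
  no archimedean Langlands parameters.

## References

* L. Clozel, *Motifs et formes automorphes*, in: Automorphic forms, Shimura varieties, and
  L-functions I, Academic Press 1990, §3.3–3.5.
* K. Buzzard, T. Gee, *The conjectural connections between automorphic representations and Galois
  representations*, LMS Lecture Notes 414 (2014), §3.1, §5.
* A. W. Knapp, *Lie Groups Beyond an Introduction*, 2nd ed., Birkhäuser 2002, Thm. 5.44.
-/

-- Mathlib idiom (Mathlib/Algebra/Lie/OfAssociative.lean); needed to mention Lie subalgebras of matrix algebras
attribute [local instance 100] LieRing.ofAssociativeRing

open scoped Classical Matrix ComplexConjugate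

open NumberField NumberField.InfinitePlace NumberField.mixedEmbedding

noncomputable section

namespace Literature.NumberTheory.Automorphic

/-! ## Entrywise Lie algebra maps on matrix algebras -/

section MapMatrix

variable {R A B : Type*} [CommRing R] [Ring A] [Ring B] [Algebra R A] [Algebra R B]
  {N : Type*} [Fintype N] [DecidableEq N]

/-- The real Lie algebra homomorphism `𝔤𝔩_N(A) →ₗ⁅R⁆ 𝔤𝔩_N(B)`, `X ↦ (f (X i j))_{i,j}`, induced by
a non-unital `R`-algebra homomorphism `f : A →ₙₐ[R] B` (commutator brackets:
`f` entrywise is multiplicative on matrices, `Matrix.map_mul`). Used for the inclusions of the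
factors `𝔤𝔩ₙ(K_w) ↪ 𝔤𝔩ₙ(K_∞)`. Knapp, *Lie Groups Beyond an Introduction*, §I.1, Example 2. [folklore] -/
def mapMatrixLie (f : A →ₙₐ[R] B) : Matrix N N A →ₗ⁅R⁆ Matrix N N B where
  toFun X := X.map f
  map_add' X Y := Matrix.map_add f (map_add f) X Y
  map_smul' c X := Matrix.map_smul f c (map_smul f c) X
  map_lie' {X Y} := by
    simp only [Ring.lie_def, Matrix.map_sub f (map_sub f), Matrix.map_mul]

/-- `mapMatrixLie f X = X.map f`. Knapp, §I.1, Example 2. [folklore] -/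
@[simp]
theorem mapMatrixLie_apply (f : A →ₙₐ[R] B) (X : Matrix N N A) : mapMatrixLie f X = X.map f :=
  rfl

end MapMatrix

/-! ## The factors of `𝔤𝔩ₙ(K_∞)` -/

section Places

variable {K : Type*} [Field K]

/-- The inclusion `ℝ = K_w ↪ K_∞ = ∏_{v real} ℝ × ∏_{v complex} ℂ` of the factor at the real place
`w`, `x ↦ ((Pi.single w x), 0)`, as a non-unital real algebra homomorphism (it does not preserve
`1`). Buzzard–Gee 2014, §3.1 (decomposition `π_∞ = ⊗_w π_w`); Mathlib's `mixedSpace`. [cite: BuzzardGee2014, §3.1 (decomposition  π_∞ = ⊗_w π_w] -/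
def realPlaceHom (w : {w : InfinitePlace K // IsReal w}) : ℝ →ₙₐ[ℝ] mixedSpace K where
  toFun x := (Pi.single w x, 0)
  map_smul' c x := Prod.ext (by dsimp; exact Pi.single_smul' w c x) (by simp)
  map_zero' := by simp
  map_add' x y := Prod.ext (by dsimp; exact Pi.single_add (f := fun _ ↦ ℝ) w x y) (by simp)
  map_mul' x y := Prod.ext (by dsimp; exact Pi.single_mul (α := fun _ ↦ ℝ) w x y) (by simp)

/-- `realPlaceHom w x = (Pi.single w x, 0)`. Buzzard–Gee 2014, §3.1. [cite: BuzzardGee2014, §3.1] -/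
@[simp]
theorem realPlaceHom_apply (w : {w : InfinitePlace K // IsReal w}) (x : ℝ) :
    realPlaceHom w x = (Pi.single w x, 0) :=
  rfl

/-- The inclusion `ℂ = K_w ↪ K_∞ = ∏_{v real} ℝ × ∏_{v complex} ℂ` of the factor at the complex
place `w`, `z ↦ (0, Pi.single w z)`, as a non-unital real algebra homomorphism. (The
identification `K_w = ℂ` is through `w.1.embedding : K →+* ℂ`, cf.
`NumberField.mixedEmbedding.mixedEmbedding_apply_isComplex`.) Buzzard–Gee 2014, §3.1. [cite: BuzzardGee2014, §3.1] -/
def complexPlaceHom (w : {w : InfinitePlace K // IsComplex w}) : ℂ →ₙₐ[ℝ] mixedSpace K where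
  toFun z := (0, Pi.single w z)
  map_smul' c z := Prod.ext (by simp) (by dsimp; exact Pi.single_smul' w c z)
  map_zero' := by simp
  map_add' x y := Prod.ext (by simp) (by dsimp; exact Pi.single_add (f := fun _ ↦ ℂ) w x y)
  map_mul' x y := Prod.ext (by simp) (by dsimp; exact Pi.single_mul (α := fun _ ↦ ℂ) w x y)

/-- `complexPlaceHom w z = (0, Pi.single w z)`. Buzzard–Gee 2014, §3.1. [cite: BuzzardGee2014, §3.1] -/
@[simp]
theorem complexPlaceHom_apply (w : {w : InfinitePlace K // IsComplex w}) (z : ℂ) :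
    complexPlaceHom w z = (0, Pi.single w z) :=
  rfl

variable (n : ℕ)

/-- The real Lie algebra inclusion `𝔤𝔩ₙ(ℝ) = 𝔤𝔩ₙ(K_w) ↪ 𝔤𝔩ₙ(K_∞)` of the factor at the real
place `w` (entrywise `realPlaceHom w`). Clozel 1990, §3.3; Buzzard–Gee 2014, §3.1. [cite: Clozel1990, §3.3] -/
def realPlaceLie (w : {w : InfinitePlace K // IsReal w}) :
    Matrix (Fin n) (Fin n) ℝ →ₗ⁅ℝ⁆ Matrix (Fin n) (Fin n) (mixedSpace K) :=
  mapMatrixLie (realPlaceHom w)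

/-- Entries of `realPlaceLie n w X`. Clozel 1990, §3.3. [cite: Clozel1990, §3.3] -/
@[simp]
theorem realPlaceLie_apply (w : {w : InfinitePlace K // IsReal w}) (X : Matrix (Fin n) (Fin n) ℝ)
    (i j : Fin n) : realPlaceLie n w X i j = (Pi.single w (X i j), 0) :=
  rfl

/-- The real Lie algebra inclusion `𝔤𝔩ₙ(ℂ) = 𝔤𝔩ₙ(K_w) ↪ 𝔤𝔩ₙ(K_∞)` of the factor at the complex
place `w` (entrywise `complexPlaceHom w`). Clozel 1990, §3.3; Buzzard–Gee 2014, §3.1. [cite: Clozel1990, §3.3] -/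
def complexPlaceLie (w : {w : InfinitePlace K // IsComplex w}) :
    Matrix (Fin n) (Fin n) ℂ →ₗ⁅ℝ⁆ Matrix (Fin n) (Fin n) (mixedSpace K) :=
  mapMatrixLie (complexPlaceHom w)

/-- Entries of `complexPlaceLie n w X`. Clozel 1990, §3.3. [cite: Clozel1990, §3.3] -/
@[simp]
theorem complexPlaceLie_apply (w : {w : InfinitePlace K // IsComplex w})
    (X : Matrix (Fin n) (Fin n) ℂ) (i j : Fin n) :
    complexPlaceLie n w X i j = (0, Pi.single w (X i j)) :=
  rfl

end Places

/-! ## Archimedean parameters and infinity types -/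

section Parameters

variable {K : Type*} [Field K] {n : ℕ} {V : Type*} [AddCommGroup V] [Module ℂ V]
  (ρ𝔤 : Matrix (Fin n) (Fin n) (mixedSpace K) →ₗ⁅ℝ⁆ Module.End ℂ V)

/-- The real Lie algebra representation `ρ𝔤` of `𝔤_∞ = 𝔤𝔩ₙ(K_∞)` on the complex space `V` has
**archimedean (Harish-Chandra / Langlands) parameter** `χ : (K →+* ℂ) → Multiset ℂ`
(indexed by complex embeddings as in Clozel and Buzzard–Gee): for every real place `w`, the
restriction of `ρ𝔤` to the factor `𝔤𝔩ₙ(ℝ) = 𝔤𝔩ₙ(K_w)` has Harish-Chandra parameter `χ σ_w`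
(`σ_w = w.embedding`, the unique embedding inducing `w`; `ℝ →ₐ[ℝ] ℂ` is a singleton), and for
every complex place `w`, the restriction to `𝔤𝔩ₙ(ℂ) = 𝔤𝔩ₙ(K_w)` (identified through
`σ_w = w.embedding`) has Harish-Chandra parameter `τ ↦ χ (τ ∘ σ_w)` for `τ : ℂ →ₐ[ℝ] ℂ`, i.e.
`χ σ_w` on the `id`-copy and `χ σ̄_w` on the `conj`-copy of `𝔤𝔩ₙ(ℂ)_ℂ = 𝔤𝔩ₙ(ℂ) × 𝔤𝔩ₙ(ℂ)`.
Clozel 1990, §3.3; Buzzard–Gee 2014, §3.1 and §5; Knapp, Thm. 5.44. [cite: Clozel1990, §3.3] -/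
def HasArchParameter (χ : (K →+* ℂ) → Multiset ℂ) : Prop :=
  (∀ w : {w : InfinitePlace K // IsReal w},
      HasHCParameter (𝕜 := ℝ) (ρ𝔤.comp (realPlaceLie n w)) fun _ ↦ χ w.1.embedding) ∧
    ∀ w : {w : InfinitePlace K // IsComplex w},
      HasHCParameter (𝕜 := ℂ) (ρ𝔤.comp (complexPlaceLie n w))
        fun τ ↦ χ ((τ : ℂ →ₐ[ℝ] ℂ).toRingHom.comp w.1.embedding)

/-- The real Lie algebra representation `ρ𝔤` of `𝔤𝔩ₙ(K_∞)` has **infinity type**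
`T : InfinityType K n` (G19): `T` is well formed (`n` weights at each `σ`, `T σ̄ = swap (T σ)`)
and the multisets `{a_i}` of `z`-exponents of `T σ = {(a_i, b_i)}` form the archimedean
parameter of `ρ𝔤`. *Subtlety:* the infinitesimal character only determines the multisets
`{a_i}` at `σ` and `{b_i} = {a_i at σ̄}`, not the pairing `(a_i, b_i)`; so `T` is not unique,
but `IsRegular`/`IsLAlgebraic`/`IsCAlgebraic`/`IsRegularAlgebraic` only read the multisets.
Clozel 1990, §3.3–3.5 (Déf. 3.6, "type à l'infini"); Buzzard–Gee 2014, §3.1. [cite: Clozel1990, §3.3–3.5 (Déf. 3.6  "type à l'infini"] -/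
def HasInfinityTypeLie (T : InfinityType K n) : Prop :=
  T.IsWellFormed ∧ HasArchParameter ρ𝔤 fun σ ↦ (T σ).map ArchWeight.a

variable {ρ𝔤} in
/-- A representation with an infinity type has, in particular, an archimedean parameter, namely
the multisets of `a`-exponents. Clozel 1990, §3.3. [cite: Clozel1990, §3.3] -/
theorem HasInfinityTypeLie.hasArchParameter {T : InfinityType K n}
    (h : HasInfinityTypeLie ρ𝔤 T) : HasArchParameter ρ𝔤 fun σ ↦ (T σ).map ArchWeight.a :=
  h.2

end Parameters

/-! ## The weight-zero infinity type -/

section WeightZero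

variable (n : ℕ) (K : Type*) [Field K]

/-- The archimedean weight `(ρ_i, -ρ_i)`, `ρ_i = (n-1)/2 - i`, i.e. the unitary character
`z ↦ z^{ρ_i} z̄^{-ρ_i} = (z/|z|)^{n-1-2i}` of `ℂˣ`; `a - b = n - 1 - 2i ∈ ℤ`.
Clozel 1990, §3.5 (Lemme de pureté 4.9 with `w = 0`); Buzzard–Gee 2014, §3.1. [cite: Clozel1990, §3.5 (Lemme de pureté 4.9 with  w = 0] -/
def weightZeroArchWeight (i : Fin n) : ArchWeight where
  a := rhoGL n i
  b := -rhoGL n i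
  exists_int_sub := ⟨(n : ℤ) - 1 - 2 * (i : ℕ), by simp only [rhoGL]; push_cast; ring⟩

/-- The `a`-exponent of `weightZeroArchWeight n i` is `ρ_i`. Clozel 1990, §3.5. [cite: Clozel1990, §3.5] -/
@[simp]
theorem weightZeroArchWeight_a (i : Fin n) : (weightZeroArchWeight n i).a = rhoGL n i :=
  rfl

/-- The `b`-exponent of `weightZeroArchWeight n i` is `-ρ_i`. Clozel 1990, §3.5. [cite: Clozel1990, §3.5] -/
@[simp]
theorem weightZeroArchWeight_b (i : Fin n) : (weightZeroArchWeight n i).b = -rhoGL n i :=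
  rfl

/-- The **weight-zero infinity type** for `GLₙ` over `K`: at every embedding `σ` the multiset
`{(ρ_i, -ρ_i) | i = 0, …, n-1}`, i.e. the restriction to `ℂˣ` of the tempered Langlands
parameter `⊕_i (z/|z|)^{n-1-2i}` — the archimedean component of a cuspidal representation
that is cohomological with respect to the trivial coefficient system (e.g. attached to a weight
`2` modular form when `n = 2`, `K = ℚ`: parameter `(1/2, -1/2), (-1/2, 1/2)`). It is regular
algebraic (`isRegularAlgebraic_weightZeroInfinityType`). Clozel 1990, §3.5 and Lemme 3.14;
Buzzard–Gee 2014, §3.1. [cite: Clozel1990, §3.5 and Lemme 3.14] -/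
def weightZeroInfinityType : InfinityType K n :=
  fun _ ↦ Finset.univ.val.map (weightZeroArchWeight n)

/-- Unfolding `weightZeroInfinityType`. Clozel 1990, §3.5. [cite: Clozel1990, §3.5] -/
@[simp]
theorem weightZeroInfinityType_apply (σ : K →+* ℂ) :
    weightZeroInfinityType n K σ = Finset.univ.val.map (weightZeroArchWeight n) :=
  rfl

variable {n} in
/-- `ρ_{rev i} = -ρ_i` (`rev i = n - 1 - i`): the half-sum of positive roots of `𝔤𝔩ₙ` is
antisymmetric under the longest Weyl element. Knapp, §V.5. [folklore] -/
theorem rhoGL_rev (i : Fin n) : rhoGL n i.rev = -rhoGL n i := by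
  have h : ((i.rev : ℕ) : ℂ) = (n : ℂ) - 1 - (i : ℕ) := by
    rw [Fin.val_rev]
    have hi : (i : ℕ) + 1 ≤ n := i.is_lt
    push_cast [Nat.cast_sub hi]
    ring
  simp only [rhoGL, h]
  ring

variable {n} in
/-- Swapping the weight `(ρ_i, -ρ_i)` gives the weight `(ρ_{rev i}, -ρ_{rev i})`.
Clozel 1990, §3.5. [cite: Clozel1990, §3.5] -/
theorem swap_weightZeroArchWeight (i : Fin n) :
    (weightZeroArchWeight n i).swap = weightZeroArchWeight n i.rev := by
  ext <;> simp [rhoGL_rev]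

variable {n} in
/-- `rhoGL n` is injective (`ρ_i = (n-1)/2 - i`). Knapp, §V.5. [folklore] -/
theorem rhoGL_injective : Function.Injective (rhoGL n) := by
  intro i j h
  simp only [rhoGL, sub_right_inj, Nat.cast_inj] at h
  exact Fin.ext h

/-- The weight-zero infinity type is well formed: `n` weights everywhere, and stable under
`swap` (it is constant in `σ`, and `swap (ρ_i, -ρ_i) = (ρ_{n-1-i}, -ρ_{n-1-i})`).
Clozel 1990, §3.3 and §3.5. [cite: Clozel1990, §3.3 and §3.5] -/
theorem isWellFormed_weightZeroInfinityType : (weightZeroInfinityType n K).IsWellFormed := by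
  refine ⟨fun σ ↦ by simp, fun σ ↦ ?_⟩
  simp only [weightZeroInfinityType_apply, Multiset.map_map, Function.comp_def,
    swap_weightZeroArchWeight]
  rw [show (fun i : Fin n ↦ weightZeroArchWeight n i.rev) = weightZeroArchWeight n ∘ Fin.revPerm
    from rfl, ← Multiset.map_map, Multiset.map_univ_val_equiv]

/-- The weight-zero infinity type is regular algebraic in Clozel's sense: `ρ_i ∈ (n-1)/2 + ℤ`,
`-ρ_i = (i + 1 - n) + (n-1)/2`, and the `ρ_i` are pairwise distinct.
Clozel 1990, Déf. 1.8, Déf. 3.12, Lemme 3.14; Buzzard–Gee 2014, §3.1. [cite: Clozel1990, Déf. 1.8  Déf. 3.12  Lemme 3.14] -/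
theorem isRegularAlgebraic_weightZeroInfinityType :
    (weightZeroInfinityType n K).IsRegularAlgebraic := by
  refine ⟨fun σ p hp ↦ ?_, fun σ ↦ ?_⟩
  · obtain ⟨i, -, rfl⟩ := Multiset.mem_map.mp hp
    refine ⟨-(i : ℕ), (i : ℕ) + 1 - n, ?_, ?_⟩
    · simp only [weightZeroArchWeight_a, rhoGL]; push_cast; ring
    · simp only [weightZeroArchWeight_b, rhoGL]; push_cast; ring
  · simp only [weightZeroInfinityType_apply, Multiset.map_map, Function.comp_def,
      weightZeroArchWeight_a]
    exact Finset.univ.nodup.map rhoGL_injective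

end WeightZero

end Literature.NumberTheory.Automorphic
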